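import Summits.CriticalPhenomena.CardyFormulaZ2.Theorems.CardySusyWardParafermionFamiliesToSLESixWiredPhaseUL
import Summits.CriticalPhenomena.CardyFormulaZ2.Theorems.CardySusyWardParafermionFamiliesToSLESixWiredPhaseLL
import Summits.CriticalPhenomena.CardyFormulaZ2.Theorems.CardySusyWardParafermionFamiliesToSLESixAnchorMomentCone
import Summits.CriticalPhenomena.CardyFormulaZ2.Theorems.CardySusyWardParafermionFamiliesToSLESixAnchorMomentCount
import Summits.CriticalPhenomena.CardyFormulaZ2.Theorems.CardyComplexConeEdgePrecompactShiftStabilityReduction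

/-!
# The concrete anchor family (skeleton r4 of line `strip-anchored-vertex-normalisation`,
# crux stmt-CriticalPhenomena-10814), XI: the wall terms of the boundary first moment, corner by corner

Helper file of the stub `stub_anchorMoment_of_IP` (assembly of the boundary first moment of the concrete
anchor data `E = anchorData δ` at level `L`, `L δ < 2 ≤ (L + 1) δ`).  The functional
`Φ(Z) = (Re Z + Im Z)/2` applied to `Z = wallPlainSum − 2(1−i)·momentSum` is the sum over the wall corners
`q = ((x, i), k)` of `ψ(q) = (Re G + Im G)/2 − 2 Im(conj ẑ · coeff i k · G)`, `G = G E δ (x,i) k`,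
`ẑ = latticePos (x, i)` (`AnchorCone.psi_eq`).  This file bounds `ψ(q)` from below, corner by corner:

* `psi_ge_exc` / `stub_anchorMomentTerms`: the CRUDE bound `ψ(q) ≥ −(4(L+1) + 1)` at every corner of the
  diamond (`‖G‖ ≤ 1` by `norm_cornerObs_le_one`, `‖ẑ‖ ≤ |x₀| + |x₁| + 1 ≤ L + 1`), used on the `O(1)` corners of
  the vertex regions;
* `psi_ge_regular`: OFF the vertex regions (`AnchorCount.regular_cases`) the corner is a regular touch/swing
  corner of one of the four sides, its observable is `sixthPhase n · P` by the landed phase packages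
  (`AnchorFree.freePhase_of_level`, `AnchorWiredLR/UL/LL.wiredPhase…_of_level`), and the cone inequalities
  (`AnchorCone.cone_*`) give `ψ(q) ≥ b(q)`, where the lower bound `b` is: the MASS `(L/2) · P(x + e₀ ↔ A)` on
  the horizontal free-side corners, the two exact upper-left linear forms (to be paired face by face in the
  assembly), and `0` elsewhere.

All elementary given the landed packages. [folklore]
-/

noncomputable section

namespace Summit.CriticalPhenomena.CardyFormulaZ2.Theorems.ParafermionFamiliesToSLESix.StripAnchored

open MeasureTheory
open Literature.Probability.LatticeModels
open Literature.Probability.Percolation (bondPercolation half BondConfig)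
open Literature.Barriers.CriticalPhenomena (medialCornersAt medialVertexOf)
open Literature.Barriers.CriticalPhenomena.HalfCRGreen (coeff twin)
open Summit.CriticalPhenomena.CardyFormulaZ2.Cruxes.EdgePrecompact.QkzStripBoundaryArm (cornerObs norm_cornerObs_le_one)
open Literature.Probability.LatticeModels.DiscreteDobrushin (startCorner exitTime)
open S2 (sixthPhase)

namespace AnchorTerms

/-! ## The lattice position of a medial vertex, in coordinates -/

/-- `ẑ_{(x,0)} = (x₀ + ½) + i x₁`. [folklore] -/
theorem latticePos_zero (x : Site 2) :
    (latticePos (x, 0)).re = x 0 + 1 / 2 ∧ (latticePos (x, 0)).im = x 1 := by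
  simp only [latticePos, medialVertexOf, medialPoint_mk, meshPoint]
  constructor
  · simp [Site.toComplex]; ring
  · simp [Site.toComplex]

/-- `ẑ_{(x,1)} = x₀ + i (x₁ + ½)`. [folklore] -/
theorem latticePos_one (x : Site 2) :
    (latticePos (x, 1)).re = x 0 ∧ (latticePos (x, 1)).im = x 1 + 1 / 2 := by
  simp only [latticePos, medialVertexOf, medialPoint_mk, meshPoint]
  constructor
  · simp [Site.toComplex]
  · simp [Site.toComplex]; ring

/-- `‖ẑ_p‖ ≤ |x₀| + |x₁| + 1` for `p = (x, i)`. [folklore] -/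
theorem norm_latticePos_le (p : Site 2 × Fin 2) : ‖latticePos p‖ ≤ |(p.1 0 : ℝ)| + |(p.1 1 : ℝ)| + 1 := by
  obtain ⟨x, i⟩ := p
  refine (Complex.norm_le_abs_re_add_abs_im _).trans ?_
  dsimp only
  fin_cases i
  · obtain ⟨hre, him⟩ := latticePos_zero x
    simp only [Fin.zero_eta, Fin.isValue] at hre him ⊢
    rw [hre, him]
    have := abs_add_le (x 0 : ℝ) (1 / 2)
    rw [abs_of_pos (show (0:ℝ) < 1 / 2 by norm_num)] at this
    linarith
  · obtain ⟨hre, him⟩ := latticePos_one x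
    simp only [Fin.mk_one, Fin.isValue] at hre him ⊢
    rw [hre, him]
    have := abs_add_le (x 1 : ℝ) (1 / 2)
    rw [abs_of_pos (show (0:ℝ) < 1 / 2 by norm_num)] at this
    linarith

/-- **The crude bound at a corner of the diamond**: if `|x₀| + |x₁| ≤ L` then
`ψ(q) ≥ −(4(L + 1) + 1)` (`‖G‖ ≤ 1`, `‖ẑ‖ ≤ L + 1`, `AnchorCone.psi_ge_neg`). [folklore] -/
theorem psi_ge_exc (E : DiscreteDobrushin) (δ : ℝ) {L : ℤ} {p : Site 2 × Fin 2} (k : Fin 4)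
    (hp : |p.1 0| + |p.1 1| ≤ L) :
    -(4 * ((L : ℝ) + 1) + 1) ≤ ((G E δ p k).re + (G E δ p k).im) / 2 -
      2 * ((starRingEnd ℂ) (latticePos p) * coeff Complex.I k * G E δ p k).im := by
  refine AnchorCone.psi_ge_neg (norm_cornerObs_le_one E δ _ _) ((norm_latticePos_le p).trans ?_) k
  have h : ((|p.1 0| + |p.1 1| : ℤ) : ℝ) ≤ L := by exact_mod_cast hp
  push_cast at h
  linarith

/-! ## The regular corners -/

variable {δ : ℝ} {L : ℤ}

section Level

variable (hδ : 0 < δ) (hLδ : (L : ℝ) * δ < 2) (hL1 : 2 ≤ ((L : ℝ) + 1) * δ) (hL : 16 ≤ L)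
  (hE : (anchorData δ).IsZdAdmissible)
  {T : Finset ((Site 2 × Fin 2) × Fin 4)}
  (hT : ∀ q, q ∈ T ↔ IsRandomMV (anchorData δ) q.1 ∧ ¬ IsRandomMV (anchorData δ) (twin q.1.1 q.1.2 q.2))

/-- The touch probability `P(w ↔ A)` of the site `w` (the free-side mass). -/
local notation3 "τA[" w "]" => (bondPercolation (zdGraph 2) half).real
  {ω : BondConfig (Site 2) | ∃ a ∈ (anchorData δ).zdArcA,
    (SimpleGraph.fromEdgeSet ((anchorData δ).bcBondConfig ω)).Reachable w a}

/-- The swing probability of the wired face `F` (the exploration visits the dart `(F, 0)`). -/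
local notation3 "σS[" F "]" => (bondPercolation (zdGraph 2) half).real
  {ω : BondConfig (Site 2) | ∃ n < exitTime hE ω,
    cornerOrbit ((anchorData δ).bcBondConfig ω) (startCorner hE) n = (F, 0)}

/-- The wall-corner functional `ψ(q) = (Re G + Im G)/2 − 2 Im(conj ẑ · coeff i k · G)`, `q = (p, k)`. -/
local notation3 "ψ[" q "]" =>
  ((G (anchorData δ) δ (q : (Site 2 × Fin 2) × Fin 4).1 (q : (Site 2 × Fin 2) × Fin 4).2).re +
    (G (anchorData δ) δ (q : (Site 2 × Fin 2) × Fin 4).1 (q : (Site 2 × Fin 2) × Fin 4).2).im) / 2 -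
  2 * ((starRingEnd ℂ) (latticePos (q : (Site 2 × Fin 2) × Fin 4).1) * coeff Complex.I (q : (Site 2 × Fin 2) × Fin 4).2 *
    G (anchorData δ) δ (q : (Site 2 × Fin 2) × Fin 4).1 (q : (Site 2 × Fin 2) × Fin 4).2).im

/-- The lower bound `b(q)`: free-side mass, the two upper-left linear forms, `0` elsewhere. -/
local notation3 "bb[" q "]" =>
  (if (q : (Site 2 × Fin 2) × Fin 4).1.2 = 0 ∧ (q : (Site 2 × Fin 2) × Fin 4).2 = 1 then
    (L : ℝ) / 2 * τA[(q : (Site 2 × Fin 2) × Fin 4).1.1 + Pi.single 0 1] else 0) +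
  (if (q : (Site 2 × Fin 2) × Fin 4).1.2 = 0 ∧ (q : (Site 2 × Fin 2) × Fin 4).2 = 0 then
    σS[(q : (Site 2 × Fin 2) × Fin 4).1.1] * ((((q : (Site 2 × Fin 2) × Fin 4).1.1 1 : ℤ) : ℝ) -
      Real.sqrt 3 * ((((q : (Site 2 × Fin 2) × Fin 4).1.1 0 : ℤ) : ℝ) + 1 / 2)) else 0) +
  (if (q : (Site 2 × Fin 2) × Fin 4).1.2 = 1 ∧ (q : (Site 2 × Fin 2) × Fin 4).2 = 0 then
    -(σS[(q : (Site 2 × Fin 2) × Fin 4).1.1 - Pi.single 0 1] *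
      (Real.sqrt 3 * (((q : (Site 2 × Fin 2) × Fin 4).1.1 0 : ℤ) : ℝ) +
        ((((q : (Site 2 × Fin 2) × Fin 4).1.1 1 : ℤ) : ℝ) + 1 / 2))) else 0)

include hδ hLδ hL1 hL hT in
/-- **The regular corners, bounded below.** Off the vertex regions, `b(q) ≤ ψ(q)`: by
`AnchorCount.regular_cases` the corner is in one of the eight regular families; the landed phase package of
its side evaluates `G = sixthPhase n · P`, and the matching cone inequality of `AnchorCone` applies (the
coordinate signs come from the family's level/column and `omega`). [folklore] -/
theorem psi_ge_regular {q : (Site 2 × Fin 2) × Fin 4} (hq : q ∈ T)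
    (hreg : ¬ (L - 8 ≤ |q.1.1 0 + q.1.1 1| ∧ L - 8 ≤ |q.1.1 0 - q.1.1 1|)) : bb[q] ≤ ψ[q] := by
  have hL4 : 4 ≤ L := by omega
  have hL' : (16 : ℝ) ≤ L := by exact_mod_cast hL
  have hc := AnchorCount.regular_cases hδ hLδ hL1 hL hT hq hreg
  obtain ⟨⟨x, i⟩, k⟩ := q
  dsimp only at hc ⊢
  obtain ⟨hre0, him0⟩ := latticePos_zero x
  obtain ⟨hre1, him1⟩ := latticePos_one x
  rcases hc with ⟨rfl, rfl, hs, hd⟩ | ⟨rfl, rfl, hs, hd⟩ | ⟨rfl, rfl, hd, hs⟩ | ⟨rfl, rfl, hd, hs⟩ |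
    ⟨rfl, rfl, hd, hs⟩ | ⟨rfl, rfl, hd, hs⟩ | ⟨rfl, rfl, hs, hd⟩ | ⟨rfl, rfl, hs, hd⟩
  · -- free side, horizontal vertex: the NE corner `(x + e₀, x)` is the out-dart of the wall site `x + e₀`
    rw [abs_le] at hd
    rw [if_pos ⟨rfl, rfl⟩, if_neg (by decide), if_neg (by decide), add_zero, add_zero]
    have h1 : (x + Pi.single 0 1 : Site 2) 0 + (x + Pi.single 0 1 : Site 2) 1 = L - 2 := by simp; omega
    have h2 : |(x + Pi.single 0 1 : Site 2) 0 - (x + Pi.single 0 1 : Site 2) 1| ≤ L - 4 := by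
      rw [abs_le]; simp; omega
    have hw := (AnchorFree.freePhase_of_level hδ hLδ hL1 hL4 hE h1 h2).1
    rw [show (x + Pi.single 0 1 : Site 2) - cornerUnit 0 = x by simp [cornerUnit]] at hw
    have hzr : 0 ≤ (latticePos (x, 0)).re := by
      rw [hre0]; have : (3 : ℝ) ≤ (x 0 : ℝ) := by exact_mod_cast (show (3 : ℤ) ≤ x 0 by omega)
      linarith
    refine le_trans ?_ (AnchorCone.cone_free_zero measureReal_nonneg hw hzr)
    rw [hre0, him0]
    have hsum : (L : ℝ) / 2 ≤ (x 0 : ℝ) + 1 / 2 + x 1 := by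
      have : ((x 0 + x 1 : ℤ) : ℝ) = L - 3 := by exact_mod_cast hs
      push_cast at this; linarith
    rw [mul_comm]
    exact mul_le_mul_of_nonneg_left hsum measureReal_nonneg
  · -- free side, vertical vertex: the NE corner `(x + e₁, x)` is the in-dart of the wall site `x + e₁`
    rw [abs_le] at hd
    rw [if_neg (by decide), if_neg (by decide), if_neg (by decide), add_zero, add_zero]
    have h1 : (x + Pi.single 1 1 : Site 2) 0 + (x + Pi.single 1 1 : Site 2) 1 = L - 2 := by simp; omega
    have h2 : |(x + Pi.single 1 1 : Site 2) 0 - (x + Pi.single 1 1 : Site 2) 1| ≤ L - 4 := by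
      rw [abs_le]; simp; omega
    have hw := (AnchorFree.freePhase_of_level hδ hLδ hL1 hL4 hE h1 h2).2
    rw [show (x + Pi.single 1 1 : Site 2) - cornerUnit 1 = x by simp [cornerUnit]] at hw
    have hzi : 0 ≤ (latticePos (x, 1)).im := by
      rw [him1]; have : (3 : ℝ) ≤ (x 1 : ℝ) := by exact_mod_cast (show (3 : ℤ) ≤ x 1 by omega)
      linarith
    exact AnchorCone.cone_free_one measureReal_nonneg hw hzi
  · -- lower-right wired side, horizontal vertex: the SE corner `(x + e₀, x - e₁)` enters the face `x - e₁`
    rw [abs_le] at hs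
    rw [if_neg (by decide), if_neg (by decide), if_neg (by decide), add_zero, add_zero]
    have h1 : (x - Pi.single 1 1 : Site 2) 0 - (x - Pi.single 1 1 : Site 2) 1 = L - 1 := by simp; omega
    have h2 : |(x - Pi.single 1 1 : Site 2) 0 + (x - Pi.single 1 1 : Site 2) 1| ≤ L - 5 := by
      rw [abs_le]; simp; omega
    have hw := (AnchorWiredLR.wiredPhaseLR_of_level hδ hLδ hL1 hL4 hE h1 h2).1
    rw [show (x - Pi.single 1 1 : Site 2) + cornerUnit 0 + cornerUnit 1 = x + Pi.single 0 1 by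
      ext j; fin_cases j <;> simp [cornerUnit]] at hw
    have hzi : (latticePos (x, 0)).im ≤ 0 := by
      rw [him0]; have : (x 1 : ℝ) ≤ (-3 : ℝ) := by exact_mod_cast (show x 1 ≤ -3 by omega)
      linarith
    exact AnchorCone.cone_LR_zero measureReal_nonneg hw hzi
  · -- lower-right wired side, vertical vertex: the SE corner `(x, x)` leaves the face `x`
    rw [abs_le] at hs
    rw [if_neg (by decide), if_neg (by decide), if_neg (by decide), add_zero, add_zero]
    have h2 : |x 0 + x 1| ≤ L - 5 := by rw [abs_le]; omega
    have hw := (AnchorWiredLR.wiredPhaseLR_of_level hδ hLδ hL1 hL4 hE hd h2).2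
    have hzr : 0 ≤ (latticePos (x, 1)).re := by
      rw [hre1]; exact_mod_cast (show (0 : ℤ) ≤ x 0 by omega)
    have hzi : (latticePos (x, 1)).im ≤ 0 := by
      rw [him1]; have : (x 1 : ℝ) ≤ (-3 : ℝ) := by exact_mod_cast (show x 1 ≤ -3 by omega)
      linarith
    exact AnchorCone.cone_LR_one measureReal_nonneg hw hzr hzi
  · -- upper-left wired side, horizontal vertex: the NW corner `(x, x)` enters the face `x`
    rw [abs_le] at hs
    rw [if_neg (by decide), if_pos ⟨rfl, rfl⟩, if_neg (by decide), zero_add, add_zero]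
    have h2 : |x 0 + x 1| ≤ L - 5 := by rw [abs_le]; omega
    have hw := (AnchorWiredUL.wiredPhaseUL_of_level hδ hLδ hL1 hL4 hE hd h2).1
    have key := AnchorCone.cone_UL_zero (z := latticePos (x, 0)) measureReal_nonneg hw
    rw [hre0, him0] at key
    exact key
  · -- upper-left wired side, vertical vertex: the NW corner `(x + e₁, x - e₀)` leaves the face `x - e₀`
    rw [abs_le] at hs
    rw [if_neg (by decide), if_neg (by decide), if_pos ⟨rfl, rfl⟩, zero_add, zero_add]
    have h1 : (x - Pi.single 0 1 : Site 2) 0 - (x - Pi.single 0 1 : Site 2) 1 = -(L - 1) := by simp; omega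
    have h2 : |(x - Pi.single 0 1 : Site 2) 0 + (x - Pi.single 0 1 : Site 2) 1| ≤ L - 5 := by
      rw [abs_le]; simp; omega
    have hw := (AnchorWiredUL.wiredPhaseUL_of_level hδ hLδ hL1 hL4 hE h1 h2).2
    rw [show (x - Pi.single 0 1 : Site 2) + cornerUnit 0 + cornerUnit 1 = x + Pi.single 1 1 by
      ext j; fin_cases j <;> simp [cornerUnit]] at hw
    have key := AnchorCone.cone_UL_one (z := latticePos (x, 1)) measureReal_nonneg hw
    rw [hre1, him1] at key
    exact key
  · -- lower-left wired side, horizontal vertex: the SW corner `(x, x - e₁)` leaves the face `x - e₁`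
    rw [abs_le] at hd
    rw [if_neg (by decide), if_neg (by decide), if_neg (by decide), add_zero, add_zero]
    have h1 : (x - Pi.single 1 1 : Site 2) 0 + (x - Pi.single 1 1 : Site 2) 1 = -L := by simp; omega
    have h2 : |(x - Pi.single 1 1 : Site 2) 0 - (x - Pi.single 1 1 : Site 2) 1| ≤ L - 5 := by
      rw [abs_le]; simp; omega
    have hw := (AnchorWiredLL.wiredPhaseLL_of_level hδ hLδ hL1 hL4 hE h1 h2).2
    rw [show (x - Pi.single 1 1 : Site 2) + cornerUnit 1 = x by simp [cornerUnit]] at hw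
    have hzi : (latticePos (x, 0)).im ≤ 0 := by
      rw [him0]; have : (x 1 : ℝ) ≤ (-3 : ℝ) := by exact_mod_cast (show x 1 ≤ -3 by omega)
      linarith
    exact AnchorCone.cone_LL_zero measureReal_nonneg hw hzi
  · -- lower-left wired side, vertical vertex: the SW corner `(x, x - e₀)` enters the face `x - e₀`
    rw [abs_le] at hd
    rw [if_neg (by decide), if_neg (by decide), if_neg (by decide), add_zero, add_zero]
    have h1 : (x - Pi.single 0 1 : Site 2) 0 + (x - Pi.single 0 1 : Site 2) 1 = -L := by simp; omega
    have h2 : |(x - Pi.single 0 1 : Site 2) 0 - (x - Pi.single 0 1 : Site 2) 1| ≤ L - 5 := by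
      rw [abs_le]; simp; omega
    have hw := (AnchorWiredLL.wiredPhaseLL_of_level hδ hLδ hL1 hL4 hE h1 h2).1
    rw [show (x - Pi.single 0 1 : Site 2) + cornerUnit 0 = x by simp [cornerUnit]] at hw
    have hzr : (latticePos (x, 1)).re ≤ 0 := by
      rw [hre1]; exact_mod_cast (show x 0 ≤ 0 by omega)
    have hzi : (latticePos (x, 1)).im ≤ 0 := by
      rw [him1]; have : (x 1 : ℝ) ≤ (-3 : ℝ) := by exact_mod_cast (show x 1 ≤ -3 by omega)
      linarith
    exact AnchorCone.cone_LL_one measureReal_nonneg hw hzr hzi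

include hδ hLδ hL1 hL hT in
/-- **Every wall corner, crudely**: `ψ(q) ≥ −(4(L+1) + 1)` (wall corners live in the diamond,
`AnchorCount.coords_of_mem`). [folklore] -/
theorem psi_ge_exc_of_mem {q : (Site 2 × Fin 2) × Fin 4} (hq : q ∈ T) : -(4 * ((L : ℝ) + 1) + 1) ≤ ψ[q] := by
  have hco := AnchorCount.coords_of_mem hδ hLδ hL1 hL hT hq
  refine psi_ge_exc (anchorData δ) δ q.2 ?_
  rcases abs_choice (q.1.1 0) with h | h <;> rcases abs_choice (q.1.1 1) with h' | h' <;> omega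

include hL in
/-- **The free-side lower bound is nonnegative**: `0 ≤ (L/2) · P(w ↔ A)`. [folklore] -/
theorem mass_nonneg (w : Site 2) : 0 ≤ (L : ℝ) / 2 * τA[w] := by
  have : (0 : ℝ) ≤ L := by exact_mod_cast (show (0:ℤ) ≤ L by omega)
  exact mul_nonneg (by linarith) measureReal_nonneg

/-- **The horizontal upper-left form is nonnegative along the side**: for `t ≤ L - 5`, `0 ≤ t`, at the face
`F = (t - (L-1), t)`: `0 ≤ σ(F) · (t − √3 (t − (L−1) + ½))`. [folklore] -/
theorem UL_form_nonneg {t : ℤ} (ht : 0 ≤ t ∧ t ≤ L - 5) :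
    0 ≤ σS[(![t - (L - 1), t] : Site 2)] *
      ((((![t - (L - 1), t] : Site 2) 1 : ℤ) : ℝ) - Real.sqrt 3 * ((((![t - (L - 1), t] : Site 2) 0 : ℤ) : ℝ) + 1 / 2)) := by
  simp only [Matrix.cons_val_zero, Matrix.cons_val_one, Matrix.cons_val_fin_one]
  refine AnchorCone.UL_zero_nonneg measureReal_nonneg ?_ ?_
  · have : ((t - (L - 1) : ℤ) : ℝ) ≤ (-4 : ℝ) := by exact_mod_cast (show t - (L - 1) ≤ -4 by omega)
    push_cast at this ⊢; linarith
  · exact_mod_cast ht.1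

end Level

end AnchorTerms

open AnchorTerms in
/-- **Registered helper `stub_anchorMomentTerms`** (of the stub `stub_anchorMoment_of_IP`, line
`strip-anchored-vertex-normalisation`, skeleton r4): the crude bound on the wall-corner functional
`ψ = (Re G + Im G)/2 − 2 Im(conj ẑ_p · coeff i k · G)` at every corner of the diamond `|x₀| + |x₁| ≤ L`:
`ψ ≥ −(4(L + 1) + 1)` (`‖G‖ ≤ 1`, `‖ẑ_p‖ ≤ L + 1`). [folklore] -/
theorem stub_anchorMomentTerms : ∀ (E : DiscreteDobrushin) (δ : ℝ) (L : ℤ) (p : Site 2 × Fin 2) (k : Fin 4), |p.1 0| + |p.1 1| ≤ L → -(4 * ((L : ℝ) + 1) + 1) ≤ ((G E δ p k).re + (G E δ p k).im) / 2 - 2 * ((starRingEnd ℂ) (latticePos p) * coeff Complex.I k * G E δ p k).im := by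
  intro E δ L p k hp
  exact psi_ge_exc E δ k hp

end Summit.CriticalPhenomena.CardyFormulaZ2.Theorems.ParafermionFamiliesToSLESix.StripAnchored

end
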